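import Summits.HodgeConjecture.HodgeConjecture.Theorems.R90S9DefiniteXiMembershipCut   -- ★ p861479 (p04): the (AE-ⅱ) text `hRig` of `definiteXiMembership_of_ch14` and all of its D6 currency
import Summits.HodgeConjecture.HodgeConjecture.Theorems.R90S5EvpOfAeRouting          -- ★ p861517 (S5): E1 string currency for EVERY hermitian `H` — `clFinChoice`, `xiFamilyOfRecord`, `evpAtIntegralLevel`
import Literature.NumberTheory.Rogawski1990.Ch14Bridge                               -- ★ the §14.6 carpet `Ch14Sec6.GlobalData` + `Ch14Bridge.thm1461_of_thm1451b_of_prop1362` (generic in `TG′`, :75–:82)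
import HarnessLib

/-!
# R90-TF · S9 «InnerForm-13.3.6 (c)» — (AE-ⅱ) JUNCTION CUT, THE ENGINE AT ONE INSTANCE — GENERIC `G′`-TEST TYPE EDITION (sibling of ★ `R90S9DefiniteAeRigidityCutEngine`)
# (Rogawski 1990 §14.6: Thm. 14.5.1 (b) ⟹ (14.6.1) ⟹ e.v.p. classification ∕ partition of `Π(G′)` ⟹ Thm. 14.6.4 `Π′ = Π′(ξ)`, read back at every non-split finite place)

Cell `hodgecm-mathlib`, crux H413 (`stmt-HodgeConjecture-24833`, lane `--supports … --as helper`), route of record `HCCMUnconditional` (no route verbs; count-neutral).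
Programme R90-TF (brief `director/R90-BRIEF.v2.md` 1f40d54518340a35), section S9 = InnerForm-13.3.6 (c) (base `R90-IF`); seat R90-IF-p06 (g0).
DEALT BY NAME: R90-IF-plan (g0) RULING S9-R-TG-2 2026-09-04T22:17:42Z (R90-IF-audit1 FLAG W2 «the engine's `TG′` is concrete» UPHELD, (W2-a) ADOPTED): «ONE mechanical hand
— `Theorems/R90S9DefiniteAeRigidityCutGeneric.lean` (SIBLING, not an in-place edition — line cap + ★ bytes frozen): `definiteAeRigidityAt_of_parts′` with
`{TG′ : Type} (Γ : Ch14Sec6.GlobalData TG′ (C_c G) (C_c H)) (Transfer : TG′ → C_c G → Prop) (TransferH : TG′ → C_c H → Prop)`, `hvan`∕`hvanH` over `TG′`, EVERYTHING ELSE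
BYTEWISE the ★ head; proof = the ★ ten lines verbatim».  WHY: RULING S9-R-TG (22:14:33Z) pins the datum `gammaSph … X`'s `G′`-test type to ★ p862002's pure-tensor PAIR type
(the currency in which `hli`∕`htr` are `rfl`), whereas the ★ engine fixed `TG′ := C_c(U(H)(𝔸))`; the deduction never inspects `TG′` (★ `Ch14Bridge.thm1461_of_thm1451b_of_prop1362`
is generic in it), so the engine is re-issued with `TG′` free and (α) `definiteAeRigidity_ofDatum` instantiates THIS head at `gammaSph … X`.  The ∀-closed companion
`definiteAeRigidity_of_parts′` (payer shape of the kit-free ∀H PRINT SHELL `SocketDefiniteAeRigidity`, OFF-PATH since S9-R-K (2)) is NOT re-issued here (line cap; no on-path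
consumer) — ★ `definiteAeRigidity_of_parts` (p862161) stands for the shell.  THEOREMS ONLY (no `def`, no instance, no notation, no named fact, no `sorry`); imports ★ only.
HONEST LABEL: HC_CM is proved only modulo the 7 printed citations (2 remaining named inputs: hLiu418 = stmt-HodgeConjecture-24832, h413 = stmt-HodgeConjecture-24833) — until
rung 0 closes.  Type plumbing of a ★ deduction; proves NOTHING printed; kernel leaves by name UNCHANGED; REL ≠ ★ ≠ BUILT.

THE PARTS, THE MATHEMATICS, THE PINS: as in ★ `R90S9DefiniteAeRigidityCutEngine` (module docstring there), verbatim — DATUM `Γ` (now over `TG′`), (S6) `h51 : Γ.thm1451b Transfer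
TransferH SθG SθH` (Thm. 14.5.1 (b) BY NAME-SHAPE [p. 238]), (S5 ∕ S8) `h62 h38 hexH hH61 hvan hvanH` (the ★ `GlobalPacketData` expansions + vanishing classes = the hypotheses of ★
`Ch14Bridge.thm1461_of_thm1451b_of_prop1362`), (S7) `h64 : Γ.thm1461 … → Γ.sec146_evp ∧ Γ.sec146_partition ∧ Γ.thm1464a` [pp. 242–244], `hD : Γ.DSplit`, PINS `π′ hm Pξ hA
hstring hevp hback` (at the datum: ★ `mPrimeSph_ne_zero`, ★ `aeString_of_ae`, ★ `evpRep_of_ae_of_evp_piXiPrime` (α2), ★ `sgTail_of_ae_of_recordSCD` (α1)).  Conclusion = the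
(S-G) tail of `hRig` BYTE FOR BYTE.  PROOF (§14.6 pp. 241–244): ★ `thm1461_of_thm1451b_of_prop1362` ⟹ `Γ.thm1461`; (S7) ⟹ `sec146_evp`, `sec146_partition`, `thm1464a`;
`P ↦ π′` lies in some `Π′` (partition (iii)); (AE) ⟹ string ⟹ `evpRep π′ Π(ξ)` ⟹ `evp Π′ Π(ξ)` (`sec146_evp` (ii)) ⟹ `Π′ ∈ Π_a(G′)`; `thm1464a` ⟹ `Π′ = Π′(ξ′)`; `hback`.
Axioms TRIO.

[cite: Rogawski1990, §14.5 Thm. 14.5.1 (b) p. 238; §14.6 Thm. 14.6.1 (14.6.1) p. 241, p. 242 (e.v.p., `Π(G′)`, (14.6.2)), Thm. 14.6.4 (14.6.3) p. 244; §13.3 Thm. 13.3.5 p. 202, p. 201; §13.6 Props. 13.6.1–13.6.2 pp. 208–210, p. 209 (e.v.p.); §13.1 Prop. 13.1.3 (d), Prop. 13.1.4 p. 199; §12.2 (2) p. 174]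
[cite: FlathCorvallis1979, Thm. 3] [cite: CartierCorvallis1979, §IV.1 Cor. 4.1]
-/

set_option autoImplicit false
-- the mandated namespace repeats `HodgeConjecture.HodgeConjecture`, as in every `Theorems/*.lean` of this sub-problem
set_option linter.dupNamespace false

noncomputable section

open NumberField IsDedekindDomain MeasureTheory
open scoped Matrix ComplexOrder

open Literature.NumberTheory Literature.NumberTheory.Automorphic Literature.NumberTheory.Automorphic.UnitaryGroup
open Literature.NumberTheory.Automorphic.IdeleClassGroup
open Literature.NumberTheory.GaloisRepresentations
open Literature.NumberTheory.Rogawski1990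

namespace Summit.HodgeConjecture.HodgeConjecture.R90.S9

open Summit.HodgeConjecture.HodgeConjecture.Cruxes.H413.F0P3ClassTokenChoice (clFinChoice)
open Summit.HodgeConjecture.HodgeConjecture.Cruxes.H413.F0P3XiLocalFamilyOfRecord (xiFamilyOfRecord)
open Summit.HodgeConjecture.HodgeConjecture.Cruxes.H413.K2E1EvpOfAutomorphicClass (evpAtIntegralLevel)

universe u v

open scoped Classical in
set_option synthInstance.maxHeartbeats 400000 in
set_option maxHeartbeats 8000000 in
/-- **ENGINE `definiteAeRigidityAt_of_parts′` — (AE-ⅱ) AT ONE INSTANCE FROM ITS §14.6 PARTS, GENERIC IN THE `G′`-TEST TYPE `TG′`** (= ★ `definiteAeRigidityAt_of_parts` (p861961) with `{TG′ : Type v} (Γ : Ch14Sec6.GlobalData TG′ …) (Transfer : TG′ → C_c(G) → Prop) (TransferH : TG′ → C_c(H) → Prop)`, every other byte unchanged; RULING S9-R-TG-2 (W2-a)).  Instance binders = the `hRig` prefix of ★ `definiteXiMembership_of_ch14` that the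
texts mention (`L H hH hHd`, the measurable frames, `Δ mH mG νG νH`, `μω hμu`, the SIGNED package `hQS`, `ξ μA P`) and the hypothesis (AE) «`t(P) = t(Π(ξ))` kit-free: off a finite
`S`, every `v`-constituent of `P` is `πⁿ(ξ_v) ∘ e` (non-split) ∕ the split member» (TEXT = `hRig`'s (AE) clause BYTE FOR BYTE).  Parts (see the module docstring): the datum `Γ`
with `Transfer ∕ TransferH`; (S6) `h51 = Γ.thm1451b …` — Thm. 14.5.1 (b) BY NAME-SHAPE [p. 238]; (S5 ∕ S8) `h62 h38 hexH hH61 hvan hvanH` — the discrete expansions and vanishing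
classes [p. 241; Props. 13.6.1–13.6.2]; (S7) `h64 : Γ.thm1461 … → Γ.sec146_evp ∧ Γ.sec146_partition ∧ Γ.thm1464a` [pp. 242–244] and `hD : Γ.DSplit`; PINS `π′ hm Pξ hA`,
`hstring : (AE) → ‹E1 string›` (★ `evpAtIntegralLevel`; S1 ∕ Flath), `hevp : ‹E1 string› → Γ.evpRep π′ Pξ`, `hback` (Thm. 14.6.4's unique `ξ` + `Π′(ξ_v) = {πⁿ, πˢ}(ξ_v)` read in
D6 currency, `πˢ ∘ e` = the `hQS`-witness).  Conclusion = `hRig`'s (S-G) tail BYTE FOR BYTE: at every non-split finite `v`, every frame `(T, a)` and Keys labels `(π², πⁿ)` with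
`πⁿ` not `L²`, every `v`-constituent of `P` is `πⁿ ∘ e ∨ π² ∘ e ∨ ((hQS ξ).1 v …).πs`.  Proof: ★ `Ch14Bridge.thm1461_of_thm1451b_of_prop1362`, then `sec146_partition` (iii),
`sec146_evp` (ii), `thm1464a`, `hback` — Rogawski's §14.6 deduction, kernel-checked; no `sorry`; axioms `propext`, `Classical.choice`, `Quot.sound`.
[cite: Rogawski1990, §14.5 Thm. 14.5.1 (b) p. 238; §14.6 Thm. 14.6.1 p. 241, p. 242, Thm. 14.6.4 p. 244; §13.3 Thm. 13.3.5 p. 202; §13.6 p. 209; §13.1 Prop. 13.1.3 (d), 13.1.4 p. 199] [cite: FlathCorvallis1979, Thm. 3] -/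
theorem definiteAeRigidityAt_of_parts'
    (L : Type) [Field L] [NumberField L] [IsCMField L] (H : Matrix (Fin 3) (Fin 3) L)
    (hH : (H.map (cmConjRingHom L))ᵀ = H) (hHd : IsUnit H.det)
    [∀ v : HeightOneSpectrum (𝓞 ↥(maximalRealSubfield L)), MeasurableSpace ((cmDatum L 3 H).Local v)]
    [∀ v : HeightOneSpectrum (𝓞 ↥(maximalRealSubfield L)),
      MeasurableSpace ((cmDatum L 2 (Matrix.of fun i j : Fin 2 => if i.val + j.val + 1 = 2 then (1 : L) else 0)).Local v ×
        (cmDatum L 1 (Matrix.of fun i j : Fin 1 => if i.val + j.val + 1 = 1 then (1 : L) else 0)).Local v)]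
    [∀ (v : HeightOneSpectrum (𝓞 ↥(maximalRealSubfield L)))
        (a : ((cmDatum L 2 (Matrix.of fun i j : Fin 2 => if i.val + j.val + 1 = 2 then (1 : L) else 0)).Local v ×
          (cmDatum L 1 (Matrix.of fun i j : Fin 1 => if i.val + j.val + 1 = 1 then (1 : L) else 0)).Local v)),
      MeasurableSpace (((cmDatum L 2 (Matrix.of fun i j : Fin 2 => if i.val + j.val + 1 = 2 then (1 : L) else 0)).Local v ×
          (cmDatum L 1 (Matrix.of fun i j : Fin 1 => if i.val + j.val + 1 = 1 then (1 : L) else 0)).Local v) ⧸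
        Subgroup.centralizer ({a} : Set ((cmDatum L 2 (Matrix.of fun i j : Fin 2 => if i.val + j.val + 1 = 2 then (1 : L) else 0)).Local v ×
          (cmDatum L 1 (Matrix.of fun i j : Fin 1 => if i.val + j.val + 1 = 1 then (1 : L) else 0)).Local v)))]
    [∀ (v : HeightOneSpectrum (𝓞 ↥(maximalRealSubfield L))) (γ : (cmDatum L 3 H).Local v),
      MeasurableSpace ((cmDatum L 3 H).Local v ⧸ Subgroup.centralizer ({γ} : Set ((cmDatum L 3 H).Local v)))]
    (Δ : ∀ v : HeightOneSpectrum (𝓞 ↥(maximalRealSubfield L)), LocalTransferFactor L H v)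
    (mH : ∀ v : HeightOneSpectrum (𝓞 ↥(maximalRealSubfield L)),
      OrbitalMeasureFamily ((cmDatum L 2 (Matrix.of fun i j : Fin 2 => if i.val + j.val + 1 = 2 then (1 : L) else 0)).Local v ×
        (cmDatum L 1 (Matrix.of fun i j : Fin 1 => if i.val + j.val + 1 = 1 then (1 : L) else 0)).Local v))
    (mG : ∀ v : HeightOneSpectrum (𝓞 ↥(maximalRealSubfield L)), OrbitalMeasureFamily ((cmDatum L 3 H).Local v))
    (νG : ∀ v : HeightOneSpectrum (𝓞 ↥(maximalRealSubfield L)), Measure ((cmDatum L 3 H).Local v))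
    (νH : ∀ v : HeightOneSpectrum (𝓞 ↥(maximalRealSubfield L)),
      Measure ((cmDatum L 2 (Matrix.of fun i j : Fin 2 => if i.val + j.val + 1 = 2 then (1 : L) else 0)).Local v ×
        (cmDatum L 1 (Matrix.of fun i j : Fin 1 => if i.val + j.val + 1 = 1 then (1 : L) else 0)).Local v))
    [∀ v : HeightOneSpectrum (𝓞 ↥(maximalRealSubfield L)), BorelSpace ((cmDatum L 3 H).Local v)]
    [∀ v : HeightOneSpectrum (𝓞 ↥(maximalRealSubfield L)),
      BorelSpace ((cmDatum L 2 (Matrix.of fun i j : Fin 2 => if i.val + j.val + 1 = 2 then (1 : L) else 0)).Local v ×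
        (cmDatum L 1 (Matrix.of fun i j : Fin 1 => if i.val + j.val + 1 = 1 then (1 : L) else 0)).Local v)]
    [∀ (v : HeightOneSpectrum (𝓞 ↥(maximalRealSubfield L)))
        (a : ((cmDatum L 2 (Matrix.of fun i j : Fin 2 => if i.val + j.val + 1 = 2 then (1 : L) else 0)).Local v ×
          (cmDatum L 1 (Matrix.of fun i j : Fin 1 => if i.val + j.val + 1 = 1 then (1 : L) else 0)).Local v)),
      BorelSpace (((cmDatum L 2 (Matrix.of fun i j : Fin 2 => if i.val + j.val + 1 = 2 then (1 : L) else 0)).Local v ×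
          (cmDatum L 1 (Matrix.of fun i j : Fin 1 => if i.val + j.val + 1 = 1 then (1 : L) else 0)).Local v) ⧸
        Subgroup.centralizer ({a} : Set ((cmDatum L 2 (Matrix.of fun i j : Fin 2 => if i.val + j.val + 1 = 2 then (1 : L) else 0)).Local v ×
          (cmDatum L 1 (Matrix.of fun i j : Fin 1 => if i.val + j.val + 1 = 1 then (1 : L) else 0)).Local v)))]
    [∀ (v : HeightOneSpectrum (𝓞 ↥(maximalRealSubfield L))) (γ : (cmDatum L 3 H).Local v),
      BorelSpace ((cmDatum L 3 H).Local v ⧸ Subgroup.centralizer ({γ} : Set ((cmDatum L 3 H).Local v)))]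
    [∀ v, (νG v).IsHaarMeasure] [∀ v, (νG v).IsMulRightInvariant] [∀ v, (νH v).IsHaarMeasure] [∀ v, (νH v).IsMulRightInvariant]
    (μω : HeckeCharacter L) (hμu : μω.IsUnitary)
    (hQS : CMCharIdentityPackageTestSigned L H hH hHd νH νG μω hμu Δ mH mG)
    (ξ : OneDimAutRepH L)
    (μA : Measure (adelicGroupData (↥(maximalRealSubfield L)) L (IsCMField.complexConj L) 3 H).automorphicQuotient)
    [(adelicGroupData (↥(maximalRealSubfield L)) L (IsCMField.complexConj L) 3 H).IsAutomorphicMeasure μA]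
    (P : DiscreteAutomorphicRep (adelicGroupData (↥(maximalRealSubfield L)) L (IsCMField.complexConj L) 3 H) μA)
    (hAE :
      (∃ S : Finset (HeightOneSpectrum (𝓞 ↥(maximalRealSubfield L))),
        (∀ v : HeightOneSpectrum (𝓞 ↥(maximalRealSubfield L)), v ∉ S →
          ∀ (hns : ∀ w : PlacesOver L v, IsCMField.complexConj L • w.1 = w.1)
            (T : GL (Fin 3) (LocalRing L v)) (a : LocalRing L v) (ha : IsUnit a)
            (h : formCongr (conjLocal L (IsCMField.complexConj L) v) T (H.map (algebraMap L (LocalRing L v))) =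
              a • (Matrix.of fun i j : Fin 3 => if i.val + j.val + 1 = 3 then (1 : L) else 0).map (algebraMap L (LocalRing L v))),
          ∀ [MeasurableSpace (Gqs L v ⧸ Subgroup.center (Gqs L v))] [BorelSpace (Gqs L v ⧸ Subgroup.center (Gqs L v))]
            (μZ : Measure (Gqs L v ⧸ Subgroup.center (Gqs L v))) [μZ.IsHaarMeasure],
          ∀ (π2 πn : IrrClass (Gqs L v)),
            KeysCaseTwoLabels L v (μω.semilocalComponent L v) (torusLocalComponent L (IsCMField.complexConj L) v ξ.η)
              (torusLocalComponent L (IsCMField.complexConj L) v ξ.ψ) π2 πn →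
            ¬ πn.IsSquareIntegrable μZ →
            ∀ c : IrrClass ((cmDatum L 3 H).Local v),
              (IrrClass.comap (localPiEquiv L (IsCMField.complexConj L) 3 H v) c).IsConstituentOf
                  (P.finRep.smoothPart.toRepresentation.comp (inclPlace (↥(maximalRealSubfield L)) L (IsCMField.complexConj L) 3 H v)) →
              c = IrrClass.comap (cmDatumLocalCongr L v T ha h).symm πn) ∧
        (∀ v : HeightOneSpectrum (𝓞 ↥(maximalRealSubfield L)), v ∉ S →
          ∀ (hs : ∃ w : PlacesOver L v, IsCMField.complexConj L • w.1 ≠ w.1),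
            ∀ c : IrrClass ((cmDatum L 3 H).Local v),
              (IrrClass.comap (localPiEquiv L (IsCMField.complexConj L) 3 H v) c).IsConstituentOf
                  (P.finRep.smoothPart.toRepresentation.comp (inclPlace (↥(maximalRealSubfield L)) L (IsCMField.complexConj L) 3 H v)) →
              c ∈ (cmSplitPacket L H hH hHd v (splitWitness v hs) (splitWitness_spec v hs) (ξ.splitν₀ μω (splitWitness v hs).1)
                (ξ.locψ (splitWitness v hs).1) (ξ.norm_splitν₀_apply hμu (splitWitness v hs).1)
                (ξ.continuous_splitν₀ μω (splitWitness v hs).1) (ξ.norm_locψ_apply (splitWitness v hs).1)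
                (ξ.continuous_locψ (splitWitness v hs).1)).members)))
    -- THE §14.6 DATUM over an ARBITRARY `G′`-test type `TG′` (RULING S9-R-TG-2 (W2-a): at `gammaSph … X` it is ★ p862002's pure-tensor PAIR type)
    {TG' : Type v} (Γ : Ch14Sec6.GlobalData.{u} TG'
      (CompactlySupportedContinuousMap (cmDatum L 3 (Matrix.of fun i j : Fin 3 => if i.val + j.val + 1 = 3 then (1 : L) else 0)).Adelic ℂ)
      (CompactlySupportedContinuousMap ((cmDatum L 2 (Matrix.of fun i j : Fin 2 => if i.val + j.val + 1 = 2 then (1 : L) else 0)).Adelic × (cmDatum L 1 (Matrix.of fun i j : Fin 1 => if i.val + j.val + 1 = 1 then (1 : L) else 0)).Adelic) ℂ))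
    (Transfer : TG' →
      (CompactlySupportedContinuousMap (cmDatum L 3 (Matrix.of fun i j : Fin 3 => if i.val + j.val + 1 = 3 then (1 : L) else 0)).Adelic ℂ) → Prop)
    (TransferH : TG' →
      (CompactlySupportedContinuousMap ((cmDatum L 2 (Matrix.of fun i j : Fin 2 => if i.val + j.val + 1 = 2 then (1 : L) else 0)).Adelic × (cmDatum L 1 (Matrix.of fun i j : Fin 1 => if i.val + j.val + 1 = 1 then (1 : L) else 0)).Adelic) ℂ) → Prop)
    -- (S6) THE S6-B EXPORT BY NAME-SHAPE — Thm. 14.5.1 (b) «θ_{G′}(f′) = SΘ_G(f) + ½ SΘ_H(f′^H)» on transfers, at the datum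
    (SθG : (CompactlySupportedContinuousMap (cmDatum L 3 (Matrix.of fun i j : Fin 3 => if i.val + j.val + 1 = 3 then (1 : L) else 0)).Adelic ℂ) → ℂ)
    (SθH : (CompactlySupportedContinuousMap ((cmDatum L 2 (Matrix.of fun i j : Fin 2 => if i.val + j.val + 1 = 2 then (1 : L) else 0)).Adelic × (cmDatum L 1 (Matrix.of fun i j : Fin 1 => if i.val + j.val + 1 = 1 then (1 : L) else 0)).Adelic) ℂ) → ℂ)
    (h51 : Γ.thm1451b Transfer TransferH SθG SθH)
    -- (S5 ∕ S8) the ★ `GlobalPacketData` discrete expansions of `SΘ_G`, `SΘ_H` (Props. 13.6.1 ∕ 13.6.2 readings + Thm. 13.3.8 packetwise) and the vanishing classes of the transfers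
    (PSVanish : (CompactlySupportedContinuousMap (cmDatum L 3 (Matrix.of fun i j : Fin 3 => if i.val + j.val + 1 = 3 then (1 : L) else 0)).Adelic ℂ) → Prop)
    (PSVanishH : (CompactlySupportedContinuousMap ((cmDatum L 2 (Matrix.of fun i j : Fin 2 => if i.val + j.val + 1 = 2 then (1 : L) else 0)).Adelic × (cmDatum L 1 (Matrix.of fun i j : Fin 1 => if i.val + j.val + 1 = 1 then (1 : L) else 0)).Adelic) ℂ) → Prop)
    (MatchH : (CompactlySupportedContinuousMap (cmDatum L 3 (Matrix.of fun i j : Fin 3 => if i.val + j.val + 1 = 3 then (1 : L) else 0)).Adelic ℂ) →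
      (CompactlySupportedContinuousMap ((cmDatum L 2 (Matrix.of fun i j : Fin 2 => if i.val + j.val + 1 = 2 then (1 : L) else 0)).Adelic × (cmDatum L 1 (Matrix.of fun i j : Fin 1 => if i.val + j.val + 1 = 1 then (1 : L) else 0)).Adelic) ℂ) → Prop)
    (h62 : Γ.G.DiscreteMinusEndoscopicExpansionG Γ.tr Γ.trH SθG PSVanish PSVanishH MatchH)
    (h38 : Γ.G.Thm1338Packetwise Γ.tr Γ.trH MatchH)
    (hexH : ∀ f, PSVanish f → ∃ fH, PSVanishH fH ∧ MatchH f fH)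
    (hH61 : Γ.G.StableDiscreteExpansionH Γ.trH SθH PSVanishH)
    (hvan : ∀ f' f, Transfer f' f → PSVanish f) (hvanH : ∀ f' fH, TransferH f' fH → PSVanishH fH)
    -- (S7) §14.6 for `D = M₃(E)`: (14.6.1) ⟹ the e.v.p. classification, the partition of `Π(G′)` and Thm. 14.6.4 (first sentence), at the datum
    (h64 : Γ.thm1461 Transfer TransferH → Γ.sec146_evp ∧ Γ.sec146_partition ∧ Γ.thm1464a)
    (hD : Γ.DSplit)
    -- PINS (readings of `P`, `Π(ξ)` in the datum; E1 ∕ S1 ∕ S3 ∕ S2)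
    (π' : Γ.Rep') (hm : Γ.m' π' ≠ 0)
    (Pξ : Γ.G.Packet) (hA : Γ.G.IsAPacket Pξ)
    (hstring :
      (∃ S : Finset (HeightOneSpectrum (𝓞 ↥(maximalRealSubfield L))),
        (∀ v : HeightOneSpectrum (𝓞 ↥(maximalRealSubfield L)), v ∉ S →
          ∀ (hns : ∀ w : PlacesOver L v, IsCMField.complexConj L • w.1 = w.1)
            (T : GL (Fin 3) (LocalRing L v)) (a : LocalRing L v) (ha : IsUnit a)
            (h : formCongr (conjLocal L (IsCMField.complexConj L) v) T (H.map (algebraMap L (LocalRing L v))) =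
              a • (Matrix.of fun i j : Fin 3 => if i.val + j.val + 1 = 3 then (1 : L) else 0).map (algebraMap L (LocalRing L v))),
          ∀ [MeasurableSpace (Gqs L v ⧸ Subgroup.center (Gqs L v))] [BorelSpace (Gqs L v ⧸ Subgroup.center (Gqs L v))]
            (μZ : Measure (Gqs L v ⧸ Subgroup.center (Gqs L v))) [μZ.IsHaarMeasure],
          ∀ (π2 πn : IrrClass (Gqs L v)),
            KeysCaseTwoLabels L v (μω.semilocalComponent L v) (torusLocalComponent L (IsCMField.complexConj L) v ξ.η)
              (torusLocalComponent L (IsCMField.complexConj L) v ξ.ψ) π2 πn →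
            ¬ πn.IsSquareIntegrable μZ →
            ∀ c : IrrClass ((cmDatum L 3 H).Local v),
              (IrrClass.comap (localPiEquiv L (IsCMField.complexConj L) 3 H v) c).IsConstituentOf
                  (P.finRep.smoothPart.toRepresentation.comp (inclPlace (↥(maximalRealSubfield L)) L (IsCMField.complexConj L) 3 H v)) →
              c = IrrClass.comap (cmDatumLocalCongr L v T ha h).symm πn) ∧
        (∀ v : HeightOneSpectrum (𝓞 ↥(maximalRealSubfield L)), v ∉ S →
          ∀ (hs : ∃ w : PlacesOver L v, IsCMField.complexConj L • w.1 ≠ w.1),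
            ∀ c : IrrClass ((cmDatum L 3 H).Local v),
              (IrrClass.comap (localPiEquiv L (IsCMField.complexConj L) 3 H v) c).IsConstituentOf
                  (P.finRep.smoothPart.toRepresentation.comp (inclPlace (↥(maximalRealSubfield L)) L (IsCMField.complexConj L) 3 H v)) →
              c ∈ (cmSplitPacket L H hH hHd v (splitWitness v hs) (splitWitness_spec v hs) (ξ.splitν₀ μω (splitWitness v hs).1)
                (ξ.locψ (splitWitness v hs).1) (ξ.norm_splitν₀_apply hμu (splitWitness v hs).1)
                (ξ.continuous_splitν₀ μω (splitWitness v hs).1) (ξ.norm_locψ_apply (splitWitness v hs).1)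
                (ξ.continuous_locψ (splitWitness v hs).1)).members)) →
        (∃ S₀ : Finset (HeightOneSpectrum (𝓞 ↥(maximalRealSubfield L))),
                    ∀ (S : Set (HeightOneSpectrum (𝓞 ↥(maximalRealSubfield L)))), (↑S₀ : Set _) ⊆ S →
                      ∀ (hP : ∀ v, v ∉ S → (clFinChoice P v).IsSpherical (cmLocalIntegralLevel L 3 H v))
                        (hξ : ∀ v, v ∉ S → (xiFamilyOfRecord L H hH hHd μω hμu ξ v).πn.IsSpherical (cmLocalIntegralLevel L 3 H v)),
                        evpAtIntegralLevel L 3 H (fun v => clFinChoice P v) S hP =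
                          evpAtIntegralLevel L 3 H (fun v => (xiFamilyOfRecord L H hH hHd μω hμu ξ v).πn) S hξ))
    (hevp :
        (∃ S₀ : Finset (HeightOneSpectrum (𝓞 ↥(maximalRealSubfield L))),
                    ∀ (S : Set (HeightOneSpectrum (𝓞 ↥(maximalRealSubfield L)))), (↑S₀ : Set _) ⊆ S →
                      ∀ (hP : ∀ v, v ∉ S → (clFinChoice P v).IsSpherical (cmLocalIntegralLevel L 3 H v))
                        (hξ : ∀ v, v ∉ S → (xiFamilyOfRecord L H hH hHd μω hμu ξ v).πn.IsSpherical (cmLocalIntegralLevel L 3 H v)),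
                        evpAtIntegralLevel L 3 H (fun v => clFinChoice P v) S hP =
                          evpAtIntegralLevel L 3 H (fun v => (xiFamilyOfRecord L H hH hHd μω hμu ξ v).πn) S hξ) →
        Γ.evpRep π' Pξ)
    (hback : ∀ (ξ' : Γ.G.PacketH) (h₁ : Γ.IsOneDimH ξ') (hS : ∀ v, v ∈ Γ.S₀ → Γ.MnNeZero ξ' v),
      Γ.evp (Γ.PiXi' ξ' h₁ hS) Pξ → Γ.mem' π' (Γ.PiXi' ξ' h₁ hS) →
        ∀ (v : HeightOneSpectrum (𝓞 ↥(maximalRealSubfield L))) (hns : ∀ w : PlacesOver L v, IsCMField.complexConj L • w.1 = w.1),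
        ∀ (T : GL (Fin 3) (LocalRing L v)) (a : LocalRing L v) (ha : IsUnit a)
          (h : formCongr (conjLocal L (IsCMField.complexConj L) v) T (H.map (algebraMap L (LocalRing L v))) =
            a • (Matrix.of fun i j : Fin 3 => if i.val + j.val + 1 = 3 then (1 : L) else 0).map (algebraMap L (LocalRing L v))),
        ∀ [MeasurableSpace (Gqs L v ⧸ Subgroup.center (Gqs L v))] [BorelSpace (Gqs L v ⧸ Subgroup.center (Gqs L v))]
          (μZ : Measure (Gqs L v ⧸ Subgroup.center (Gqs L v))) [μZ.IsHaarMeasure],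
        ∀ (π2 πn : IrrClass (Gqs L v)),
        ∀ (hK : KeysCaseTwoLabels L v (μω.semilocalComponent L v) (torusLocalComponent L (IsCMField.complexConj L) v ξ.η)
            (torusLocalComponent L (IsCMField.complexConj L) v ξ.ψ) π2 πn)
          (hn : ¬ πn.IsSquareIntegrable μZ),
          -- (S-G) «13.3.6 (c) ∕ §14.6 AT PRINT'S PINNED DATA»: every v-constituent of P is πⁿ ∘ e, π² ∘ e, or the πˢ(ξ_v) ∘ e of `hQS`
          ∀ c : IrrClass ((cmDatum L 3 H).Local v),
            (IrrClass.comap (localPiEquiv L (IsCMField.complexConj L) 3 H v) c).IsConstituentOf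
                (P.finRep.smoothPart.toRepresentation.comp (inclPlace (↥(maximalRealSubfield L)) L (IsCMField.complexConj L) 3 H v)) →
            c = IrrClass.comap (cmDatumLocalCongr L v T ha h).symm πn ∨
              c = IrrClass.comap (cmDatumLocalCongr L v T ha h).symm π2 ∨
              c = ((hQS ξ).1 v hns T a ha h μZ π2 πn hK hn).πs) :
      ∀ (v : HeightOneSpectrum (𝓞 ↥(maximalRealSubfield L))) (hns : ∀ w : PlacesOver L v, IsCMField.complexConj L • w.1 = w.1),
      ∀ (T : GL (Fin 3) (LocalRing L v)) (a : LocalRing L v) (ha : IsUnit a)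
        (h : formCongr (conjLocal L (IsCMField.complexConj L) v) T (H.map (algebraMap L (LocalRing L v))) =
          a • (Matrix.of fun i j : Fin 3 => if i.val + j.val + 1 = 3 then (1 : L) else 0).map (algebraMap L (LocalRing L v))),
      ∀ [MeasurableSpace (Gqs L v ⧸ Subgroup.center (Gqs L v))] [BorelSpace (Gqs L v ⧸ Subgroup.center (Gqs L v))]
        (μZ : Measure (Gqs L v ⧸ Subgroup.center (Gqs L v))) [μZ.IsHaarMeasure],
      ∀ (π2 πn : IrrClass (Gqs L v)),
      ∀ (hK : KeysCaseTwoLabels L v (μω.semilocalComponent L v) (torusLocalComponent L (IsCMField.complexConj L) v ξ.η)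
          (torusLocalComponent L (IsCMField.complexConj L) v ξ.ψ) π2 πn)
        (hn : ¬ πn.IsSquareIntegrable μZ),
        -- (S-G) «13.3.6 (c) ∕ §14.6 AT PRINT'S PINNED DATA»: every v-constituent of P is πⁿ ∘ e, π² ∘ e, or the πˢ(ξ_v) ∘ e of `hQS`
        ∀ c : IrrClass ((cmDatum L 3 H).Local v),
          (IrrClass.comap (localPiEquiv L (IsCMField.complexConj L) 3 H v) c).IsConstituentOf
              (P.finRep.smoothPart.toRepresentation.comp (inclPlace (↥(maximalRealSubfield L)) L (IsCMField.complexConj L) 3 H v)) →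
          c = IrrClass.comap (cmDatumLocalCongr L v T ha h).symm πn ∨
            c = IrrClass.comap (cmDatumLocalCongr L v T ha h).symm π2 ∨
            c = ((hQS ξ).1 v hns T a ha h μZ π2 πn hK hn).πs := by
  intro v hns T a ha h _ _ μZ _ π2 πn hK hn c hc
  -- (S6) + (S5 ∕ S8) ⟹ (14.6.1) at the datum: the book's three-line proof of Thm. 14.6.1, ★ `Ch14Bridge.thm1461_of_thm1451b_of_prop1362`
  have h61 : Γ.thm1461 Transfer TransferH :=
    Ch14Bridge.thm1461_of_thm1451b_of_prop1362 Γ Transfer TransferH h62 h38 hexH hH61 hvan hvanH h51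
  -- (S7) ⟹ e.v.p. classification + partition + Thm. 14.6.4 (a)
  obtain ⟨hevp', hpart, h64a⟩ := h64 h61
  -- `P` occurs discretely, hence lies in a global L-packet `Π′` of `G′` [§14.6 p. 242]
  obtain ⟨P', hmem⟩ := hpart.2.2 π' hm
  -- (AE) ⟹ `t(P) = t(Π(ξ))` (E1 string) ⟹ `t(Π′) = t(Π(ξ))`, so `Π′ ∈ Π_a(G′)` [§14.6 p. 242]
  have hevpP : Γ.evp P' Pξ := (hevp'.2 π' P' Pξ hmem).1 (hevp (hstring hAE))
  have hInA : Γ.InA' P' := ⟨⟨π', hmem, hm⟩, Pξ, hevpP, hA⟩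
  -- Thm. 14.6.4 (first sentence): `Π′ = Π′(ξ′)` [p. 244]; read back locally (pin)
  obtain ⟨ξ', h₁, hS, hP'⟩ := h64a hD P' hInA
  subst hP'
  exact hback ξ' h₁ hS hevpP hmem v hns T a ha h μZ π2 πn hK hn c hc

end Summit.HodgeConjecture.HodgeConjecture.R90.S9

end
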